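import Summits.QuantumFields.QCD.Theses.FemtoStepScaling
import HarnessLib.Audit

/-!
# Birth skeleton (BC3) for the crux `InfiniteVolumePackageC` (item stmt-QuantumFields-17665)

Route `FemtoStepScaling` (sub-problem QCD), crux decl
`Summit.QuantumFields.QCD.Theses.FemtoStepScaling.InfiniteVolumePackageC` (rank 6; rev 3 of
`InfiniteVolumePackageR` stmt-QuantumFields-11451 — THE PACKAGE, card F5):

  `∀ N_f ∈ [2,3], ∀ reg, GOOD reg → (∀ m > 0, UV finite-volume data of reg at m) →
     (∃ M₀ ≥ 0, (∀ m > M₀, ∃ Δ > 0, gluonic uniform lattice gap Δ at m) ∧ (lattice gap closes at M₀⁺)) → QCDOf N_f`.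

Registered by the skeleton-registrar seat `planner-skel-stmt-QuantumFields-17665-0` (route re-audit bin REPAIRABLE,
2026-08-17) as `Cruxes/InfiniteVolumePackageC/Lines/birth.lean`.  It is the route-level BIRTH CERTIFICATE of the
crux (≥ 2 named stubs, a kernel-checked composition concluding the crux BY NAME, `sorry` only inside `stub_*`),
deliberately LINE-NEUTRAL: it cuts the package along the route header's own two-layer plan
("InfiniteVolumePackageC ⇐ GluonicToHadronic → OSReconstructionWithGap (the Mχ-shift is three lines)") into
one LATTICE law, one THERMODYNAMIC-LIMIT/OS law and one CONTINUUM-GAP law, with the `m_crit`-shift by the offset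
`M₀` PROVED inside the composition (it is bookkeeping, not a stub):

* `stub_gluonicToHadronicGap : GluonicToHadronicGapStmt` (size L / open) — for `N_f ∈ [2,3]`, every GOOD `reg`
  (mass scaling, asymptotic scaling, `m_crit(k) > −1` eventually), every POSITIVE tuple `m` carrying the UV
  finite-volume data, and every rate `Δ > 0`: the GLUONIC uniform lattice gap at `m` (connected Euclidean-time
  correlations of all pairs of bounded gauge-invariant cylinder functions of the gauge field, on every torus
  `2S+1 ≥ 2L_k+1`, `n ≤ S`, eventually in `k`, rate `Δ a_k`) extends to the FULL uniform lattice gap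
  `(reg.scheme m 0 0).HasLatticeMassGap Δ'` for some `Δ' > 0` (ALL gauge-invariant local lattice QCD observables:
  mesons, baryons, Wilson loops × quark polynomials).  Rate loss allowed (pions below glueballs: `Δ' < Δ` expected).
* `stub_thermodynamicOSLimit : ThermodynamicOSLimitStmt` (size XL / open — the heart of the package) — for GOOD
  `reg`, positive `m` with UV finite-volume data (convergence of the renormalised smeared `n`-point functions on
  EVERY fixed physical torus `ℓ ≥ ℓ₀`, pairwise-disjoint supports, with the non-degeneracy witnesses N1–N3) and a
  full uniform lattice gap `Δ > 0` at `m`: there are species renormalisations `z, shift` and OS data `T` with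
  `IsQCDAlong (reg.scheme m z shift) T` (limits along the scheme's OWN growing tori `2L_k+1`, `a_k L_k → ∞`, on all
  off-diagonal tensors; asymptotic scaling and the physical branch `m_f(k) > −1` come from GOOD and `m > 0`),
  non-trivial and non-Gaussian glue and non-decoupled flavour-changing pseudoscalars (volume independence from
  clustering, OS axioms E0–E4 incl. rotation invariance of the lattice limit, N1–N3 transported to infinite volume).
* `stub_gapInheritance : GapInheritanceStmt` (size M/L; verbatim the statement registered for the sibling crux
  `MassiveBridge`, `Cruxes/MassiveBridge/Lines/birth.lean` S3 — a shared lemma of the QCD packages) — for every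
  scheme `sch`, OS data `T` and `Δ > 0`: `IsQCDAlong sch T` and `sch.HasLatticeMassGap Δ` give some `Δ' ∈ (0, Δ]`
  with `T.HasMassGap Δ'` (uniform lattice clustering passes to the limits on off-diagonal real tensors, which are
  total for the OS reconstruction of `T`; Laplace-transform / spectral-measure argument).

`InfiniteVolumePackageC_of : GluonicToHadronicGapStmt → ThermodynamicOSLimitStmt → GapInheritanceStmt →
InfiniteVolumePackageC` (hypotheses spelled through the name-keyed aliases `__Registered.stub_*`, so that the native
skeleton audit admits them BY NAME) is kernel-checked: the witness of `QCDOf N_f` is the `M₀`-SHIFTED regularisation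
`shiftReg reg M₀` (`m_crit(k) ↦ m_crit(k) + a_k M₀ / Z_m(k)`; `HasMassScaling` is literally kept, `shiftReg_scheme`:
its scheme at `m'` is `reg`'s scheme at `M₀ + m'`); its `IsChiralAtZero` is LITERALLY the transported edge clause
(`∀ ε ∃ m > M₀ ¬gap ε` at `reg` ↦ the tuple `m − M₀ > 0` of the shifted regularisation, `shiftReg_scheme_sub`); and for
`m' > 0` the tuple `m = M₀ + m' > M₀ ≥ 0` is positive, so the crux's UV clause applies at `m`, the offset clause gives a
gluonic rate `Δ`, S1 the full lattice gap `Δ₁`, S2 the data `(z, shift, T)`, S3 (lattice clause moved to the data's own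
scheme — it reads only `β_k, m_f(k), L_k, a_k`, `hasLatticeMassGap_scheme_iff` by `Iff.rfl`) a continuum rate
`Δ₂ ≤ Δ₁`, and the lattice gap is weakened to the common rate `Δ₂` (`hasLatticeMassGap_mono`, proved here); the body
is transported back to the shifted regularisation by `shiftReg_scheme`.  `infiniteVolumePackageC_of_stubs :
InfiniteVolumePackageC` instantiates it.

## Negative knowledge honoured (read 2026-08-17)
* `Cruxes/InfiniteVolumePackageC/` had NO workfiles before this one (no `Disproof.lean`, no dead lines, no
  `_false_without_` obstructions to honour); the crux's evidence is the repair planner's rev-3 `Sketch.lean`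
  (farm rc 0: restated items + `closes` + the two transport examples `EDGE(0) ↔ IsChiralAtZero` = `Iff.rfl` and the
  `M₀`-shift by `QCDScheme.mk.injEq` + `ring`, re-proved here as `shiftReg_scheme` / `shiftReg_scheme_sub`).
* `ledger negatives --problem QuantumFields` (5 entries: RobustYangMillsRG stmt-14958, MirrorModularBoosts
  stmt-9665, AdaptiveCoarseSystem stmt-9494, MultibosonLatticeGap stmt-9599, AdmissibleRootsExist stmt-9603 —
  all bespoke admissibility predicates inhabited by wild witnesses or unsatisfiable).  Lesson applied: every stub is
  phrased over the Statement's / the crux's OWN vocabulary (`IsQCDAlong`, `HasMassScaling`, `HasLatticeMassGap`,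
  `HasMassGap`, `IsNontrivial`, `IsNonGaussian`, and the crux's verbatim UV / gluonic-gap clauses); no new predicate,
  no stub is an instance of a refuted statement.
* Junk witnesses: `Ex ≡ 0` (vanishing twisted partition function) makes the gluonic hypothesis AND the lattice
  conclusion of S1 hold together; the vacuum data inhabit `IsQCDAlong` (`isQCDAlong_zeroAF_vacuum`) and every
  `HasMassGap` (`vacuum_hasMassGap`), so S3's vacuum instance is true; S2's hypothesis carries the crux's
  non-degeneracy witnesses N1–N3 (time-separated / pairwise-disjoint), which white noise, contact terms, `z ≡ 0` and
  decoupled quarks fail (rev-1 repair of the route), so its hypothesis is not junk-inhabited.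
* Typing checklist 4c: no Bochner integral over a free function is introduced (the only `∫` sit inside the tree's
  `qcdTorusExpect`, copied verbatim from the crux), no hand-picked threshold or rate (`M₀, Δ, Δ', Δ₁, Δ₂`
  existential / universally guarded), no determinantal or complex-action positivity claim.

## BC3 probes (planner folder `bc/`): for each stub statement `S`, `S → InfiniteVolumePackageC` and `S → QCD` by
`first | exact? | simpa | aesop` FAIL (files `bc/probe_<stub>_{crux,summit}.lean`; rc and goals in NOTES.md and
`Lines/birth.md`).
-/

noncomputable section

namespace Summit.QuantumFields.QCD.Cruxes.InfiniteVolumePackageC.Birth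

open scoped BigOperators Topology Classical
open MeasureTheory Filter
open Literature.MathematicalPhysics.QuantumFieldTheory
open Summit.QuantumFields.QCD.Theses.FemtoStepScaling

/-! ## §0 Currency — the crux's own sub-formulae, named (copied VERBATIM from the route decl) -/

/-- **GOOD trajectory clauses of `reg`** (the crux's third hypothesis, verbatim): leading-log mass scaling,
two-loop asymptotic scaling of the bare coupling, and the physical branch `m_crit(k) > −1` eventually. -/
def Good (Nf : ℕ) (reg : QCDRegularisation Nf) : Prop :=
  (reg.HasMassScaling ∧ (∃ Λ > 0, Tendsto (fun k => reg.β k - afBeta Nf Λ (reg.a k)) atTop (nhds 0)) ∧ (∀ᶠ k in atTop, (-1 : ℝ) < reg.mcrit k))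

/-- **UV finite-volume continuum data of `reg` at the tuple `m`** (the body of the crux's UV hypothesis at `m`,
verbatim = the per-tuple conclusion of `FiniteVolumeContinuumLimitC`): species renormalisations `z, shift`, a limit
functional `W` and `ℓ₀ > 0` with (CONV) convergence of the renormalised smeared `n`-point functions under
`qcdTorusExpect` on the torus of side `2⌊ℓ/2a_k⌋+1`, for every `ℓ ≥ ℓ₀`, every species string and real test
functions with PAIRWISE-DISJOINT closed supports; (N2) every flavour-changing `pseudoRe f g` has a time-separated
connected two-point value `≠ 0`; (N1) glue has one too; (N3) glue has a pairwise-disjoint connected three-point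
value `κ₃ ≠ 0`. -/
def UVData (Nf : ℕ) (reg : QCDRegularisation Nf) (m : Fin Nf → ℝ) : Prop :=
  ∃ z shift : QCDField Nf → ℕ → ℝ, ∃ W : ((ℓ : ℝ) → (n : ℕ) → (Fin n → QCDField Nf) → (Fin n → SchwartzMap (EuclideanSpace ℝ (Fin 4)) ℝ) → ℂ), ∃ ℓ₀ > 0, (∀ ℓ : ℝ, ℓ₀ ≤ ℓ → ∀ (n : ℕ) (σ : Fin n → QCDField Nf) (f : Fin n → SchwartzMap (EuclideanSpace ℝ (Fin 4)) ℝ), (∀ i j : Fin n, i ≠ j → Disjoint (tsupport (f i)) (tsupport (f j))) → Tendsto (fun k => qcdTorusExpect (reg.β k) (2 * ⌊ℓ / (2 * reg.a k)⌋₊ + 1) (fun fl => (reg.scheme m 0 0).mq fl k) (fun U => (List.ofFn fun i : Fin n => (∑ x ∈ Literature.Probability.LatticeModels.box 4 ⌊ℓ / (2 * reg.a k)⌋₊, ((z (σ i) k * reg.a k ^ 4 * (f i) (reg.a k • Literature.MathematicalPhysics.QuantumLattice.siteToE x) : ℝ) : ℂ) • (insertion U (σ i) x - algebraMap ℂ _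 (((shift (σ i) k) : ℝ) : ℂ)))).prod)) atTop (nhds (W ℓ n σ f))) ∧ (∀ fl gl : Fin Nf, fl ≠ gl → ∃ ℓ : ℝ, ℓ₀ ≤ ℓ ∧ ∃ f g : SchwartzMap (EuclideanSpace ℝ (Fin 4)) ℝ, tsupport f ⊆ {x | x 0 < 0} ∧ tsupport g ⊆ {x | 0 < x 0} ∧ W ℓ 2 (fun _ => QCDField.pseudoRe fl gl) ![f, g] ≠ W ℓ 1 (fun _ => QCDField.pseudoRe fl gl) ![f] * W ℓ 1 (fun _ => QCDField.pseudoRe fl gl) ![g]) ∧ ∀ s₀ : QCDField Nf, s₀ = QCDField.glue → (∃ ℓ : ℝ, ℓ₀ ≤ ℓ ∧ ∃ f g : SchwartzMap (EuclideanSpace ℝ (Fin 4)) ℝ, tsupport f ⊆ {x | x 0 < 0} ∧ tsupport g ⊆ {x | 0 < x 0} ∧ W ℓ 2 (fun _ => s₀) ![f, g] ≠ W ℓ 1 (fun _ => s₀) ![f] * W ℓ 1 (fun _ => s₀) ![g]) ∧ (∃ ℓ : ℝ, ℓ₀ ≤ ℓ ∧ ∃ f g h : SchwartzMap (EuclideanSpace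 ℝ (Fin 4)) ℝ, Disjoint (tsupport f) (tsupport g) ∧ Disjoint (tsupport f) (tsupport h) ∧ Disjoint (tsupport g) (tsupport h) ∧ W ℓ 3 (fun _ => s₀) ![f, g, h] - W ℓ 1 (fun _ => s₀) ![f] * W ℓ 2 (fun _ => s₀) ![g, h] - W ℓ 1 (fun _ => s₀) ![g] * W ℓ 2 (fun _ => s₀) ![f, h] - W ℓ 1 (fun _ => s₀) ![h] * W ℓ 2 (fun _ => s₀) ![f, g] + 2 * (W ℓ 1 (fun _ => s₀) ![f] * W ℓ 1 (fun _ => s₀) ![g] * W ℓ 1 (fun _ => s₀) ![h]) ≠ 0)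

/-- **Gluonic uniform lattice gap of rate `Δ` at the tuple `m`** (the body of the crux's offset hypothesis at
`m, Δ`, verbatim): for all bounded gauge-invariant cylinder functions `A, B` of the gauge field there is `C` with,
eventually in `k`, on every torus `2S+1 ≥ 2L_k+1` at `(β_k, m_f(k))` and for all `n ≤ S`,
`‖⟨A · τ_{n e₀} B⟩ − ⟨A⟩⟨τ_{n e₀} B⟩‖ ≤ C e^{−Δ a_k n}` under the honest lattice-QCD functional `qcdTorusExpect`. -/
def GluonicGap (Nf : ℕ) (reg : QCDRegularisation Nf) (m : Fin Nf → ℝ) (Δ : ℝ) : Prop :=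
  (∀ A B : YMSpecies (Matrix.specialUnitaryGroup (Fin 3) ℂ), ∃ C : ℝ, ∀ᶠ k in atTop, ∀ S : ℕ, reg.L k ≤ S → ∀ Ex : (GaugeConfig 4 (2 * S + 1) (Matrix.specialUnitaryGroup (Fin 3) ℂ) → FermiAlg Nf (2 * S + 1)) → ℂ, Ex = qcdTorusExpect (reg.β k) (2 * S + 1) (fun fl => (reg.scheme m 0 0).mq fl k) → ∀ ι : ℝ → FermiAlg Nf (2 * S + 1), ι = (fun r : ℝ => algebraMap ℂ _ (r : ℂ)) → ∀ n : ℕ, n ≤ S → ‖(Ex (fun U => ι (A.F (Literature.MathematicalPhysics.QuantumLattice.torusLift (2 * S + 1) U)) * ι (B.F (Literature.MathematicalPhysics.QuantumLattice.configShift (-(Pi.single (0 : Fin 4) ((n : ℕ) : ℤ))) (Literature.MathematicalPhysics.QuantumLattice.torusLift (2 * S + 1) U)))) - Ex (fun U => ι (A.F (Literature.MathematicalPhysics.QuantumLattice.torusLift (2 * S + 1) U))) * Ex (fun U => ι (B.F (Literature.MathematicalPhysics.QuantumLattice.configShift (-(Pi.single (0 : Fin 4) ((n : ℕ) : ℤ)))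 (Literature.MathematicalPhysics.QuantumLattice.torusLift (2 * S + 1) U)))))‖ ≤ C * Real.exp (-((Δ) * (reg.a k * n))))

/-- **The per-tuple BODY of `QCDOf` along `reg` at `m`** (verbatim the matrix of `_root_.QCDOf` after its three
outer binders): species renormalisations, OS data tied to lattice QCD along `reg.scheme m z shift`, non-trivial
non-Gaussian glue, dynamical quarks, and ONE rate `Δ > 0` for the continuum AND the full lattice gap. -/
def Body (Nf : ℕ) (reg : QCDRegularisation Nf) (m : Fin Nf → ℝ) : Prop :=
  ∃ (z shift : QCDField Nf → ℕ → ℝ) (T : OSData (QCDField Nf) 4),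
    IsQCDAlong (reg.scheme m z shift) T ∧ T.IsNontrivial QCDField.glue ∧ T.IsNonGaussian QCDField.glue ∧
      (∀ f g : Fin Nf, f ≠ g → T.IsNontrivial (QCDField.pseudoRe f g)) ∧
        ∃ Δ > 0, T.HasMassGap Δ ∧ (reg.scheme m z shift).HasLatticeMassGap Δ

/-! ## §1 The three stub statements -/

/-- **(S1) Gluonic-to-hadronic extension of the uniform lattice gap** (route header: "extend the lattice gap from
gluonic to ALL gauge-invariant observables (mesons, baryons)"; size L / open).  For `N_f ∈ [2,3]`, every GOOD
regularisation, every positive tuple `m` carrying the UV finite-volume data, and every `Δ > 0`: the gluonic uniform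
lattice gap of rate `Δ` at `m` yields the FULL uniform lattice gap `(reg.scheme m 0 0).HasLatticeMassGap Δ'` for some
`Δ' > 0` (every pair of `QCDLatticeObservable`s — bounded link functions × quark polynomials, jointly gauge
invariant — on all tori `2S+1 ≥ 2L_k+1`, eventually in `k`).  Why plausibly true: by Lüscher's positive transfer
matrix on the physical branch (`m_f(k) > m_crit(k) > −1`), a gluonic gap forbids light flavour-singlet states, in
particular two-pion and baryon–antibaryon thresholds, so every flavour / baryon-number sector is gapped and the
lightest hadron sets `Δ' > 0`; heavy or decoupled quarks only help (hopping expansion).  Why it might fail: decay of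
QUARK observables needs control of `D_W[U]⁻¹` on exceptional configurations near `κ_c` under a SIGNED determinant,
uniformly in the volume — the gluonic clause does not see them; and the sector argument is spectral while the
finite-torus functional is the `(−1)^F`-twisted trace.  Size: L / open. -/
def GluonicToHadronicGapStmt : Prop :=
  ∀ (Nf : ℕ) (reg : QCDRegularisation Nf) (m : Fin Nf → ℝ) (Δ : ℝ), 2 ≤ Nf → Nf ≤ 3 → Good Nf reg →
    (∀ fl, 0 < m fl) → UVData Nf reg m → 0 < Δ → GluonicGap Nf reg m Δ →
      ∃ Δ' : ℝ, 0 < Δ' ∧ (reg.scheme m 0 0).HasLatticeMassGap Δ'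

/-- **(S2) Thermodynamic limit and OS reconstruction with non-degeneracy** (route header: "pass to infinite
volume along the scheme's own tori (volume independence from clustering), build the OS data (E0–E4 as fields, E0'
growth, rotation invariance; convergence upgraded from disjoint-support product tensors on fixed tori to all
IsOffDiagonal tensors on the growing tori), read IsNontrivial / IsNonGaussian / dynamical quarks off N1–N3"; size
XL / open — the heart of the package).  For `N_f ∈ [2,3]`, every GOOD regularisation, every positive tuple `m` with
UV finite-volume data and a full uniform lattice gap `Δ > 0` at `m`: there are `z, shift` and OS data `T` with
`IsQCDAlong (reg.scheme m z shift) T`, `T.IsNontrivial glue`, `T.IsNonGaussian glue` and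
`T.IsNontrivial (pseudoRe f g)` for all `f ≠ g`.  Why plausibly true: exponential clustering uniform in the volume
makes the torus `n`-point functions Cauchy in the volume at fixed spacing (finite-size effects `O(e^{−Δ' ℓ})`), so the
fixed-torus limits `W ℓ` converge as `ℓ → ∞` and agree with the limits along the scheme's tori; `a`-uniform bounds
give E0/E0', lattice symmetries E1 up to rotations, reflection positivity of Wilson gauge + Wilson fermions E2,
E3 by construction, E4 from the gap.  Why it might fail: full `SO(4)` invariance of a (subsequential) lattice limit
is not automatic; E0' (`n!` growth) needs bounds uniform in `n`; and the non-degeneracy witnesses N1–N3 live at SOME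
finite `ℓ ≥ ℓ₀` each and must survive `ℓ → ∞` (no monotonicity in the volume is known for signed-determinant QCD).
Size: XL / open. -/
def ThermodynamicOSLimitStmt : Prop :=
  ∀ (Nf : ℕ) (reg : QCDRegularisation Nf) (m : Fin Nf → ℝ) (Δ : ℝ), 2 ≤ Nf → Nf ≤ 3 → Good Nf reg →
    (∀ fl, 0 < m fl) → UVData Nf reg m → 0 < Δ → (reg.scheme m 0 0).HasLatticeMassGap Δ →
      ∃ (z shift : QCDField Nf → ℕ → ℝ) (T : OSData (QCDField Nf) 4),
        IsQCDAlong (reg.scheme m z shift) T ∧ T.IsNontrivial QCDField.glue ∧ T.IsNonGaussian QCDField.glue ∧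
          ∀ f g : Fin Nf, f ≠ g → T.IsNontrivial (QCDField.pseudoRe f g)

/-- **(S3) Continuum gap inheritance** (route header: "T.HasMassGap Δ from the lattice gap"; size M/L; the SAME
statement as `Cruxes/MassiveBridge/Lines/birth.lean` S3 — one shared lemma serves both packages).  For every scheme
`sch`, OS data `T` and rate `Δ > 0`: if `T` is QCD along `sch` (all lattice `n`-point functions of the species fields
converge to `T`'s Schwinger functions on off-diagonal real tensors) and the lattice theories of `sch` have the uniform
full-spectrum lattice gap `Δ`, then `T.HasMassGap Δ'` for some `0 < Δ' ≤ Δ` (uniform exponential clustering of ALL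
truncated Schwinger functions of `T`: `σ(H) ⊆ {0} ∪ [Δ', ∞)`, `0` simple, on the full OS space of `T`).  Why plausibly
true: the smeared species fields are finite sums of translates of local lattice observables, so their connected
Euclidean-time correlations inherit the lattice decay in physical units; the bound passes to the `k → ∞` limits on
off-diagonal real tensors, which generate a total set of the OS reconstruction of `T`; a Laplace-transform argument
on spectral measures upgrades clustering on a total set to the spectral gap.  Why it might fail (as typed): the
constants of `HasLatticeMassGap` are per pair of observables, not uniform over the `O(a_k⁻⁴)` spatial translates
entering a smeared field, and the scheme's functional is the finite-torus `(−1)^F`-twisted trace.  Size: M/L. -/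
def GapInheritanceStmt : Prop :=
  ∀ (Nf : ℕ) (sch : QCDScheme Nf) (T : OSData (QCDField Nf) 4) (Δ : ℝ),
    IsQCDAlong sch T → 0 < Δ → sch.HasLatticeMassGap Δ →
      ∃ Δ' : ℝ, 0 < Δ' ∧ Δ' ≤ Δ ∧ T.HasMassGap Δ'

/-! ## §2 The registered stubs (the ONLY `sorry`s of this file) -/

/-- (S1) gluonic-to-hadronic extension of the uniform lattice gap — size L / open. -/
theorem stub_gluonicToHadronicGap : GluonicToHadronicGapStmt := by
  sorry

/-- (S2) thermodynamic limit + OS reconstruction with non-degeneracy — size XL / open. -/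
theorem stub_thermodynamicOSLimit : ThermodynamicOSLimitStmt := by
  sorry

/-- (S3) continuum gap inheritance through OS reconstruction — size M/L. -/
theorem stub_gapInheritance : GapInheritanceStmt := by
  sorry

/-! ### Name-keyed aliases of the three statements (hypotheses of the composition)

`__Registered.stub_X` is statement `X` under the registered stub's short name, so that the native skeleton audit
(`#h21_check_skeleton`: hypotheses admissible iff registered obligations / declared stubs BY NAME) accepts
`InfiniteVolumePackageC_of : __Registered.stub_gluonicToHadronicGap → … → InfiniteVolumePackageC` (device of
`Cruxes/RotationRestoration/Lines/birth.lean`, `Cruxes/RobustYangMills/Lines/cross-plane-hankel-rigidity.lean`).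
The aliases are `abbrev`s (reducibly the statements), so `stub_X : __Registered.stub_X` definitionally. -/
namespace __Registered

/-- Alias of `GluonicToHadronicGapStmt` keyed by the registered stub name. -/
abbrev stub_gluonicToHadronicGap : Prop := GluonicToHadronicGapStmt
/-- Alias of `ThermodynamicOSLimitStmt` keyed by the registered stub name. -/
abbrev stub_thermodynamicOSLimit : Prop := ThermodynamicOSLimitStmt
/-- Alias of `GapInheritanceStmt` keyed by the registered stub name. -/
abbrev stub_gapInheritance : Prop := GapInheritanceStmt

end __Registered

/-! ## §3 Composition (kernel-checked; no `sorry` below this line) -/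

variable {Nf : ℕ}

/-- The `m_crit`-SHIFTED regularisation: `m_crit(k) ↦ m_crit(k) + a_k M / Z_m(k)` (renormalised masses `m'` of the
shifted regularisation are the tuples `M + m'` of `reg`; all mass-independent data and `Z_m` unchanged). [folklore] -/
def shiftReg (reg : QCDRegularisation Nf) (M : ℝ) : QCDRegularisation Nf :=
  { reg with mcrit := fun k => reg.mcrit k + reg.a k * M / reg.Zm k }

/-- The scheme of the shifted regularisation at `m` is `reg`'s scheme at `M + m`. [folklore] -/
theorem shiftReg_scheme (reg : QCDRegularisation Nf) (M : ℝ) (m : Fin Nf → ℝ)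
    (z shift : QCDField Nf → ℕ → ℝ) :
    (shiftReg reg M).scheme m z shift = reg.scheme (fun f => M + m f) z shift := by
  simp only [shiftReg, QCDRegularisation.scheme, QCDScheme.mk.injEq, true_and, and_true]
  funext f k
  ring

/-- The scheme of the shifted regularisation at `m − M` is `reg`'s scheme at `m` (the transport of the edge). [folklore] -/
theorem shiftReg_scheme_sub (reg : QCDRegularisation Nf) (M : ℝ) (m : Fin Nf → ℝ)
    (z shift : QCDField Nf → ℕ → ℝ) :
    (shiftReg reg M).scheme (fun f => m f - M) z shift = reg.scheme m z shift := by
  simp only [shiftReg, QCDRegularisation.scheme, QCDScheme.mk.injEq, true_and, and_true]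
  funext f k
  ring

/-- Mass scaling does not read `m_crit`. [folklore] -/
theorem shiftReg_hasMassScaling_iff (reg : QCDRegularisation Nf) (M : ℝ) :
    (shiftReg reg M).HasMassScaling ↔ reg.HasMassScaling :=
  Iff.rfl

/-- The lattice gap clause of a regularisation's scheme does not read the species renormalisations `z, shift`
(only `β_k, m_f(k), L_k, a_k`): definitional. [folklore] -/
theorem hasLatticeMassGap_scheme_iff (reg : QCDRegularisation Nf) (m : Fin Nf → ℝ)
    (z shift : QCDField Nf → ℕ → ℝ) (Δ : ℝ) :
    (reg.scheme m z shift).HasLatticeMassGap Δ ↔ (reg.scheme m 0 0).HasLatticeMassGap Δ :=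
  Iff.rfl

/-- **Monotonicity of the uniform lattice gap in the rate**: a lattice gap `Δ` is a lattice gap `Δ' ≤ Δ`
(the constant is replaced by `max C 0`; `a_k n ≥ 0`). [folklore] -/
theorem hasLatticeMassGap_mono (sch : QCDScheme Nf) {Δ Δ' : ℝ}
    (h : sch.HasLatticeMassGap Δ) (hle : Δ' ≤ Δ) : sch.HasLatticeMassGap Δ' := by
  intro R R' A B
  obtain ⟨C, hC⟩ := h R R' A B
  refine ⟨max C 0, ?_⟩
  filter_upwards [hC] with k hk S hS n hn
  have h1 := hk S hS n hn
  have han : 0 ≤ sch.a k * (n : ℝ) := mul_nonneg (sch.a_pos k).le (Nat.cast_nonneg n)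
  have hexp : Real.exp (-(Δ * (sch.a k * n))) ≤ Real.exp (-(Δ' * (sch.a k * n))) :=
    Real.exp_le_exp.2 (by nlinarith)
  exact h1.trans ((mul_le_mul_of_nonneg_right (le_max_left C 0) (Real.exp_pos _).le).trans
    (mul_le_mul_of_nonneg_left hexp (le_max_right C 0)))

/-- **The per-tuple body from the three laws** at a positive tuple with UV data and a gluonic rate: S1 gives the
full lattice rate `Δ₁`, S2 the data `(z, shift, T)`, S3 (lattice clause moved to the data's own scheme) a continuum
rate `Δ₂ ≤ Δ₁`, and the lattice gap is weakened to the common rate `Δ₂`. -/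
theorem body_of_laws (hS1 : GluonicToHadronicGapStmt) (hS2 : ThermodynamicOSLimitStmt)
    (hS3 : GapInheritanceStmt) (reg : QCDRegularisation Nf) (m : Fin Nf → ℝ) (h2 : 2 ≤ Nf) (h3 : Nf ≤ 3)
    (hg : Good Nf reg) (hm : ∀ fl, 0 < m fl) (huv : UVData Nf reg m) {Δ : ℝ} (hΔ : 0 < Δ)
    (hgl : GluonicGap Nf reg m Δ) : Body Nf reg m := by
  obtain ⟨Δ₁, hΔ₁, hlat⟩ := hS1 Nf reg m Δ h2 h3 hg hm huv hΔ hgl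
  obtain ⟨z, shift, T, hqcd, hglue, hng, hps⟩ := hS2 Nf reg m Δ₁ h2 h3 hg hm huv hΔ₁ hlat
  have hlat' : (reg.scheme m z shift).HasLatticeMassGap Δ₁ :=
    (hasLatticeMassGap_scheme_iff reg m z shift Δ₁).2 hlat
  obtain ⟨Δ₂, hΔ₂, hle, hT⟩ := hS3 Nf (reg.scheme m z shift) T Δ₁ hqcd hΔ₁ hlat'
  exact ⟨z, shift, T, hqcd, hglue, hng, hps, Δ₂, hΔ₂, hT, hasLatticeMassGap_mono _ hlat' hle⟩

/-- **The crux from the three stubs** (concludes `InfiniteVolumePackageC` BY NAME).  The witness of `QCDOf N_f` is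
the `M₀`-shifted regularisation: mass scaling kept (`Iff.rfl`), chirality at zero = the transported gapless edge
(`shiftReg_scheme_sub`), and for every positive `m'` the body at the positive tuple `M₀ + m' > M₀ ≥ 0` of `reg`
(UV clause at that tuple, gluonic rate from the offset clause, `body_of_laws`) transported by `shiftReg_scheme`. -/
theorem InfiniteVolumePackageC_of :
    __Registered.stub_gluonicToHadronicGap → __Registered.stub_thermodynamicOSLimit →
      __Registered.stub_gapInheritance →
        Summit.QuantumFields.QCD.Theses.FemtoStepScaling.InfiniteVolumePackageC := by
  intro hS1 hS2 hS3
  unfold Summit.QuantumFields.QCD.Theses.FemtoStepScaling.InfiniteVolumePackageC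
  intro Nf reg h2 h3 hgood huv hoff
  obtain ⟨M₀, hM₀, hgap, hedge⟩ := hoff
  have hg : Good Nf reg := hgood
  unfold QCDOf
  refine ⟨shiftReg reg M₀, (shiftReg_hasMassScaling_iff reg M₀).2 hg.1, ?_, ?_⟩
  · -- chirality at zero of the shifted regularisation IS the edge clause at `M₀` of `reg`
    intro ε hε
    obtain ⟨m, hm, hng⟩ := hedge ε hε
    refine ⟨fun f => m f - M₀, fun f => sub_pos.2 (hm f), ?_⟩
    rw [shiftReg_scheme_sub]
    exact hng
  · -- the body at every positive tuple `m'` of the shifted regularisation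
    intro m' hm'
    have hmM : ∀ f, M₀ < M₀ + m' f := fun f => lt_add_of_pos_right _ (hm' f)
    have hmpos : ∀ f, (0 : ℝ) < M₀ + m' f := fun f => hM₀.trans_lt (hmM f)
    obtain ⟨Δ, hΔ, hgl⟩ := hgap (fun f => M₀ + m' f) hmM
    have huv' : UVData Nf reg (fun f => M₀ + m' f) := huv (fun f => M₀ + m' f) hmpos
    have hb : Body Nf reg (fun f => M₀ + m' f) :=
      body_of_laws hS1 hS2 hS3 reg (fun f => M₀ + m' f) h2 h3 hg hmpos huv' hΔ hgl
    obtain ⟨z, shift, T, hrest⟩ := hb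
    refine ⟨z, shift, T, ?_⟩
    rw [shiftReg_scheme]
    exact hrest

/-- The crux along this skeleton, from the registered stubs (sorries only inside `stub_*`). -/
theorem infiniteVolumePackageC_of_stubs :
    Summit.QuantumFields.QCD.Theses.FemtoStepScaling.InfiniteVolumePackageC :=
  InfiniteVolumePackageC_of stub_gluonicToHadronicGap stub_thermodynamicOSLimit stub_gapInheritance

end Summit.QuantumFields.QCD.Cruxes.InfiniteVolumePackageC.Birth

end
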